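import Summits.Ventures.DiscreteObjects.PP12.OrderThirteenCollineation

/-!
# PP(12), order-13 cell: relabelling invariance of the lift normal form (kernel; first brick of a symmetry reduction for a certificate)
Framing: lottery ticket; floor = certified bounds/negative ranges.

Cell pub-namedobj (venture DiscreteObjects), target (M), designs gen 18. The typed census statement `NoLiftData13` (`OrderThirteenCollineation`:
no valid lift data `LiftData 11 13`; decided EMPTY outside the kernel over 38 orbit-matrix classes, in print Janko–van Trung 1981/82; EXACT by
`OrderThirteenLift.noLiftData13_iff`) quantifies over LABELLED data: the `N` free line orbits `s` and the `N` free point orbits `t` carry arbitrary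
labels. Any kernel certificate must quotient by these relabellings (`S_N × S_N`; designs g16 HANDOFF (e)). Here: `LiftData.relabel D ρ τ`
(`mem s t x := D.mem (ρ s) (τ t) x`) and **`LiftData.valid_relabel_iff : (D.relabel ρ τ).Valid ↔ D.Valid`** — each clause (`RowPartition`, `Internal`,
`Cross`) is transported along the bijections. Consequence: to refute all valid lift data it suffices to refute those in any normal form reachable by
relabelling (`noLiftData13_of_normalized`). Pure logic about the typed statement; nothing asserts any census statement. No `sorry`, no new axioms.
-/

namespace Summit.Ventures.DiscreteObjects.PP12

namespace LiftData

variable {N p : ℕ} [NeZero p]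

/-- relabel the free line orbits by `ρ` and the free point orbits by `τ` -/
def relabel (D : LiftData N p) (ρ τ : Equiv.Perm (Fin N)) : LiftData N p :=
  ⟨fun s t x => D.mem (ρ s) (τ t) x⟩

omit [NeZero p] in
/-- the membership table of relabelled data -/
@[simp] theorem relabel_mem (D : LiftData N p) (ρ τ : Equiv.Perm (Fin N)) (s t : Fin N) (x : Fin p) :
    (D.relabel ρ τ).mem s t x = D.mem (ρ s) (τ t) x := rfl

/-- (M·U) transported: row `s` of the relabelled data is row `ρ s` of the data, its blocks reindexed by `τ` -/
theorem rowPartition_relabel_iff (D : LiftData N p) (ρ τ : Equiv.Perm (Fin N)) (s : Fin N) :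
    (D.relabel ρ τ).RowPartition s ↔ D.RowPartition (ρ s) := by
  unfold RowPartition
  simp only [relabel_mem]
  constructor
  · rintro ⟨h0, h1⟩
    refine ⟨fun t => by simpa using h0 (τ.symm t), fun x hx => ?_⟩
    obtain ⟨t, ht, huniq⟩ := h1 x hx
    refine ⟨τ t, ht, fun t' ht' => ?_⟩
    have e := huniq (τ.symm t') (by simpa using ht')
    rw [← e, Equiv.apply_symm_apply]
  · rintro ⟨h0, h1⟩
    refine ⟨fun t => h0 (τ t), fun x hx => ?_⟩
    obtain ⟨t, ht, huniq⟩ := h1 x hx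
    refine ⟨τ.symm t, by simpa using ht, fun t' ht' => ?_⟩
    have e := huniq (τ t') ht'
    rw [← e, Equiv.symm_apply_apply]

/-- (U·U) transported -/
theorem internal_relabel_iff (D : LiftData N p) (ρ τ : Equiv.Perm (Fin N)) (s : Fin N) :
    (D.relabel ρ τ).Internal s ↔ D.Internal (ρ s) := by
  unfold Internal
  simp only [relabel_mem]
  constructor
  · intro h δ hδ
    obtain ⟨t, x, h1, h2, huniq⟩ := h δ hδ
    refine ⟨τ t, x, h1, h2, fun t' x' h1' h2' => ?_⟩
    obtain ⟨e1, e2⟩ := huniq (τ.symm t') x' (by simpa using h1') (by simpa using h2')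
    exact ⟨by rw [← e1, Equiv.apply_symm_apply], e2⟩
  · intro h δ hδ
    obtain ⟨t, x, h1, h2, huniq⟩ := h δ hδ
    refine ⟨τ.symm t, x, by simpa using h1, by simpa using h2, fun t' x' h1' h2' => ?_⟩
    obtain ⟨e1, e2⟩ := huniq (τ t') x' h1' h2'
    exact ⟨by rw [← e1, Equiv.symm_apply_apply], e2⟩

/-- (U·U′) transported -/
theorem cross_relabel_iff (D : LiftData N p) (ρ τ : Equiv.Perm (Fin N)) (s s' : Fin N) :
    (D.relabel ρ τ).Cross s s' ↔ D.Cross (ρ s) (ρ s') := by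
  unfold Cross
  simp only [relabel_mem]
  constructor
  · rintro ⟨hd, h⟩
    refine ⟨fun t x => hd (τ.symm t) x |> fun hn => by simpa using hn, fun δ hδ => ?_⟩
    obtain ⟨t, x, h1, h2, huniq⟩ := h δ hδ
    refine ⟨τ t, x, h1, h2, fun t' x' h1' h2' => ?_⟩
    obtain ⟨e1, e2⟩ := huniq (τ.symm t') x' (by simpa using h1') (by simpa using h2')
    exact ⟨by rw [← e1, Equiv.apply_symm_apply], e2⟩
  · rintro ⟨hd, h⟩
    refine ⟨fun t x => hd (τ t) x, fun δ hδ => ?_⟩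
    obtain ⟨t, x, h1, h2, huniq⟩ := h δ hδ
    refine ⟨τ.symm t, x, by simpa using h1, by simpa using h2, fun t' x' h1' h2' => ?_⟩
    obtain ⟨e1, e2⟩ := huniq (τ t') x' h1' h2'
    exact ⟨by rw [← e1, Equiv.symm_apply_apply], e2⟩

/-- **relabelling invariance of the lift normal form** -/
theorem valid_relabel_iff (D : LiftData N p) (ρ τ : Equiv.Perm (Fin N)) : (D.relabel ρ τ).Valid ↔ D.Valid := by
  unfold Valid
  simp only [rowPartition_relabel_iff, internal_relabel_iff, cross_relabel_iff]
  constructor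
  · rintro ⟨h1, h2⟩
    refine ⟨fun s => by simpa using h1 (ρ.symm s), fun s s' hne => ?_⟩
    have := h2 (ρ.symm s) (ρ.symm s') (fun e => hne (by simpa using congrArg ρ e))
    simpa using this
  · rintro ⟨h1, h2⟩
    exact ⟨fun s => h1 (ρ s), fun s s' hne => h2 (ρ s) (ρ s') (fun e => hne (ρ.injective e))⟩

omit [NeZero p] in
/-- relabelling twice with inverse permutations gives the data back -/
theorem relabel_relabel_symm (D : LiftData N p) (ρ τ : Equiv.Perm (Fin N)) : (D.relabel ρ τ).relabel ρ.symm τ.symm = D := by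
  cases D
  simp only [relabel, Equiv.apply_symm_apply]

end LiftData

/-- **Symmetry reduction for a certificate of `NoLiftData13`:** if every valid lift data has SOME relabelling in a normal form `NF`, it suffices
to refute the valid data in normal form. (The normal form and the covering argument are the certificate designer's choice; pure logic here.) -/
theorem noLiftData13_of_normalized (NF : LiftData 11 13 → Prop)
    (hcover : ∀ D : LiftData 11 13, D.Valid → ∃ ρ τ : Equiv.Perm (Fin 11), NF (D.relabel ρ τ))
    (hNF : ∀ D : LiftData 11 13, NF D → ¬ D.Valid) : NoLiftData13 := by
  intro D hD
  obtain ⟨ρ, τ, hnf⟩ := hcover D hD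
  exact hNF _ hnf ((LiftData.valid_relabel_iff D ρ τ).2 hD)

end Summit.Ventures.DiscreteObjects.PP12
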